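import Summits.QuantumFields.YangMills.Theses.UnitScaleTilt
import Literature.MathematicalPhysics.QuantumFieldTheory.Balaban1983to89.T3SplitLog
import Literature.MathematicalPhysics.QuantumFieldTheory.Balaban1983to89.T3UpperLiftSplitLog
import Literature.MathematicalPhysics.QuantumFieldTheory.Balaban1983to89.T3ExistSplit
import Summits.QuantumFields.YangMills.Theorems.UnitScaleTiltMinimiserStabilityRegPrAvgActionDefect
import Summits.QuantumFields.YangMills.Theorems.UnitScaleTiltMinimiserStabilityRegPrAvgCurvGrad
import Summits.QuantumFields.YangMills.Theorems.UnitScaleTiltMinimiserStabilityRegPrAttainmentOfLeaves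
import Summits.QuantumFields.YangMills.Theorems.UnitScaleTiltMinimiserStabilityRegPrSmoothLift
import Summits.QuantumFields.YangMills.Theorems.UnitScaleTiltMinimiserStabilityRegPrCritCurvGradLog
import Summits.QuantumFields.YangMills.Theorems.UnitScaleTiltMinimiserStabilityRegPrProp8Iter
import Summits.QuantumFields.YangMills.Theorems.UnitScaleTiltMinimiserStabilityRegPrAttainmentOfExist
import HarnessLib

/-!
# LAYER-4 BIRTH v9 CANDIDATE of the K1 crux child «MinimiserStabilityRegPr» (stmt-QuantumFields-19200) = registered v8 (5b4e846794b80374) WITH THE FOUR PROP-7 ROWS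
# `stub_PV3A ∕ stub_PV3C ∕ stub_PV3D ∕ stub_PV3E` REPLACED BY THE SINGLE ROW THE v8 PEN ACTUALLY CONSUMES: `stub_existMinimal` = [Balaban1985Variational] PROP. 7 (ii)
# («existence of a minimal orbit over a (14)-background», reading R1) — DRAFT by width seat ym-ust-19200-w2 g0 for the route owner (ym3-torus-plan); NOT registered
# (the skeleton of record is the owner's call; registration by OPS on an R-request only); stubs {stub_halvingStep, stub_existMinimal}.
#
# v9 CHANGE (located, w2 `Theorems/UnitScaleTiltMinimiserStabilityRegPrAttainmentOfExist.lean`).  In v8 the V3 theorem `prop7From14_v8` (⇐ A ∧ C ∧ D ∧ E) is used exactly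
# once, as the input `H7` of `Variational.minSixAttainedAt_of_prop7_prop8`, and that theorem with its two lemmas projects `H7` on its SECOND clause only.  Prop. 7 (i)
# («at most one critical orbit»), hence [Balaban1985RegularSpaces] Thm 2's chart (`stub_PV3A`), Props 5–6 (`stub_PV3C`), the return to (18) (`stub_PV3D`, landed p589019)
# and (141)–(142) (`stub_PV3E`) served ONLY print's internal route to the existence clause and the idle uniqueness clause.  v9 keeps the composition of v8 byte-for-byte
# below `variational_of_leaves_log`, feeds attainment by `AttainmentOfExist.minSixAttainedAt_of_exist_prop8 (stub_existMinimal …) landed_prop8`, and drops the four rows.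
# Interchangeable text for the new stub (modulo `stub_halvingStep`): `∃ B₃′ â₀ â₁ > 0, T3ExistSplit.MinSixAttainedAt L â₀ â₁ B₃′` ([Balaban1985Variational] Thm 1 (8),
# reading R1) — `AttainmentOfExist.existMinimal_of_att` one way, `minSixAttainedAt_of_exist_prop8` the other.  Print's proof of the new stub IS Prop. 7 (ii): Sect. A
# background, Props 2–6 (contraction (116)–(121)), [Balaban1985RegularSpaces] Prop. 7, (142); the v8 rows and w1∕w2's letters (`Prop7SPrint`, `Prop7TPrint`,
# `Prop7PV3CDE*`, `Prop7B8Prop7*`) remain the typed route INTO it and are cited, not deleted.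
# (v8 header kept in the tree file `Lines/birth_v8.lean` for the record.)

WHY V4′ (HOME/UV3-NODE.md §21; evidence #36 on 19200): unchanged from v7∕v8 — V4′ is the log-Lipschitz statement `CritCurvGradLogAt` (LANDED, p511133).

Stubs (sorries ONLY here) — v9: `stub_halvingStep` (V2′, verbatim v7∕v8), `stub_existMinimal` (V3 (ii), NEW; the v7 text of `stub_prop7From14` with its first clause and
the `ε₀, a₀` binders deleted).  Theorems with no sorry of their own: `landed_prop8` (V2 ⇐ V2′, `Prop8Iter`), `stub_critCurvGradLog` (V4′, p511133), `landed_smoothLift`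
(p466834), `landed_avgCurvGrad` (p440643), `landed_avgActionDefect` (p437535), `variational_of_leaves_log` (attainment now by `AttainmentOfExist.minSixAttainedAt_of_exist_prop8`),
and the composition `MinimiserStabilityRegPr_of` (verbatim v8), which concludes the route decl BY NAME.
-/

noncomputable section

open MeasureTheory Filter Topology
open scoped Matrix.Norms.L2Operator
open Literature.MathematicalPhysics.QuantumFieldTheory.Balaban1983to89
open Literature.MathematicalPhysics.QuantumFieldTheory.Balaban1983to89.T3ContinuumYM3Torus
open Literature.MathematicalPhysics.QuantumFieldTheory.Balaban1983to89.T3UnitLawDensityEML (ℰp measurableE_ℰp)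
open Literature.MathematicalPhysics.QuantumFieldTheory.Balaban1983to89.T3UnitScaleTilt
open Literature.MathematicalPhysics.QuantumFieldTheory.Balaban1983to89.T3TiltDescent
open Literature.MathematicalPhysics.QuantumFieldTheory.Balaban1983to89.T3CruxEstimates
open Literature.MathematicalPhysics.QuantumFieldTheory.Balaban1983to89.T3ConstrainedMinimiser
open Literature.MathematicalPhysics.QuantumFieldTheory.Balaban1983to89.T3DescentFibreTower
open Literature.MathematicalPhysics.QuantumFieldTheory.Balaban1983to89.T3MinimiserStabilityReduction
open Literature.MathematicalPhysics.QuantumFieldTheory.Balaban1983to89.T3RegularMinimiser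
open Literature.MathematicalPhysics.QuantumFieldTheory.Balaban1983to89.T3PrintedRegularMinimiser
open Literature.MathematicalPhysics.QuantumFieldTheory.Balaban1983to89.T3PrintedRegularMinimiserReduction
open Literature.MathematicalPhysics.QuantumFieldTheory.Balaban1983to89.T3PrintedMinimiserExistence
open Literature.MathematicalPhysics.QuantumFieldTheory.Balaban1983to89.T3LowerAlongMinimisersSplit
open Literature.MathematicalPhysics.QuantumFieldTheory.Balaban1983to89.T3AvgDivergenceSplit
open Literature.MathematicalPhysics.QuantumFieldTheory.Balaban1983to89.T3UpperAlongMinimisersSplit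
open Literature.MathematicalPhysics.QuantumFieldTheory.Balaban1983to89.T3UpperLiftSplit
open Literature.MathematicalPhysics.QuantumFieldTheory.Balaban1983to89.T3LowerActionSplit
open Literature.MathematicalPhysics.QuantumFieldTheory.Balaban1983to89.T3ExistSplit
open Literature.MathematicalPhysics.QuantumFieldTheory.Balaban1983to89.T3Thm1Carrier
open Literature.MathematicalPhysics.QuantumFieldTheory.Balaban1983to89.T3CurvGradLog
open Literature.MathematicalPhysics.QuantumFieldTheory.Balaban1983to89.T3SplitLog
open Literature.MathematicalPhysics.QuantumFieldTheory.Balaban1983to89.T3UpperLiftSplitLog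
open Literature.MathematicalPhysics.QuantumFieldTheory.Balaban1983to89.B11 (Prop8Printed)

namespace Summit.QuantumFields.YangMills.Cruxes.MinimiserStabilityRegPr.BirthV9

/-! ## §1 Registered stubs (each a genuine lemma of the line; sorries live ONLY here) -/

/-- STUB V2′ — THE ONE-STEP HALVING of [Balaban1985Variational] Sect. F at the d = 3 carriers (p. 304, verbatim: «hence U_k belongs to the space (2) with
max{B₃ε₁, ½ε₀} instead of ε₀»; Sect. F p. 300: «We will use only the fact that they are critical configurations of the functional (5) and that they belong to the
spaces (6) with ε₀ sufficiently small»), for SOME B₃ > 4 and a₅ > 0: `Prop8Printed`'s binders with the conclusion HALVED — for every member `i` (block size `L`,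
heights `n < K`), `0 < ε₁`, every (7)-datum `V`, every `U ∈ 𝔘_k(ε₀) ∩ 𝔅_k(V)` critical in reading R2, `ε₀ ≤ a₅` ⇒ `U ∈ 𝔘_k(max{B₃ε₁, ½ε₀})` (OWNER RULING g20-№2 (B1)).
Equivalent readings (p1 g14 `Prop8Iter.halvingLiteral_iff_halvingStep` / `…_iff_native`): `∀ i, B11Prop8Assembly.HalvingStep (famX L i) B₃ a₅`,
`T3Thm1CarrierNative.HalvingNativeAt L a₅ B₃`; reducible to MINIMISERS over (6)(ε₀), `0 < ε₀ ≤ a₅` (`Prop8Iter.halvingLiteral_of_minimisers`).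
Content (work map, owner (B3)): [Balaban1985RegularSpaces] Thm 2 gauge (152), the flat constrained propagators of [Balaban1984PropagatorsII] (2.47)–(2.51) (162)–(164),
the datum bound (160), smallness (165)–(168). XL. [cite: Balaban1985Variational, Sect. F p.304 before Prop. 8] -/
theorem stub_halvingStep : ∀ (L : ℕ), 1 < L → ∃ B₃ : ℝ, 4 < B₃ ∧ ∃ a₅ : ℝ, 0 < a₅ ∧
    ∀ (i : Idx L) (ε₀ ε₁ : ℝ), 0 < ε₁ → ∀ (V : (famX L i).Bdry) (U : (famX L i).Cfg), (famX L i).Reg7 ε₁ V → (famX L i).InU ε₀ U →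
      (famX L i).InB V U → (famX L i).IsCritical V U → ε₀ ≤ a₅ → (famX L i).InU (max (B₃ * ε₁) (ε₀ / 2)) U := by
  sorry

/-- STUB V3 (ii) — [Balaban1985Variational] PROPOSITION 7, EXISTENCE CLAUSE, FROM A BACKGROUND (14) (p. 299 «there exists exactly one critical orbit … it is a minimal
orbit», the existence half; reading R1 of «minimal orbit» = `T3Thm1Carrier.varProblem3.OnMinimalOrbit e V U`: `U ∈ (6)(e)` minimises the Wilson action over (6)(e)): for every
B₃ > 4 SOME `a₁′ > 0`, `O₁ ≥ 1` such that for every member `i`, `0 < ε₁ ≤ a₁′`, every (7)-datum `V` and every background `U₀ ∈ 𝔘_k(L³B₃ε₁) ∩ 𝔅_k(V)` there is a configuration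
on a minimal orbit of (6)(O₁L³B₃ε₁).  = the SECOND clause of v7's `stub_prop7From14` ∕ v8's `prop7From14_v8`, the only one the composition reads (w2
`AttainmentOfExist`).  Interchangeable modulo `stub_halvingStep` with the attainment schema `∃ B₃′ â₀ â₁ > 0, MinSixAttainedAt L â₀ â₁ B₃′` (Thm 1 (8), reading R1).
Content = print's Prop. 7 (ii): the v8 rows A (Thm 2 chart, w1), C (Props 5–6: contraction (116)–(121)), D (LANDED p589019 `PV3D.stub_PV3D`), E ((141)–(142), in print's
regime), knit by `Prop7PV3CDEAtSPrint.prop7From14At_v8` ∕ `Prop7PV3CUniqueness.prop7From14At_v8_of_A_Cuniq_att`; or any direct attainment argument.  XL.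
Why it might fail: only with print — it is Thm 1's existence statement at radius `O₁L³B₃ε₁`. [cite: Balaban1985Variational, Prop. 7 p.299, Thm 1 (8) p.279, (14) p.280] -/
theorem stub_existMinimal : ∀ (L : ℕ), 1 < L → ∀ B₃ : ℝ, 4 < B₃ →
    ∃ a₁' O₁ : ℝ, 0 < a₁' ∧ 1 ≤ O₁ ∧ ∀ (i : Idx L) (ε₁ : ℝ), 0 < ε₁ → ε₁ ≤ a₁' → ∀ V : (famX L i).Bdry, (famX L i).Reg7 ε₁ V →
      ∀ U₀ : (famX L i).Cfg, (famX L i).InU ((L : ℝ) ^ 3 * B₃ * ε₁) U₀ → (famX L i).InB V U₀ →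
        ∃ U : (famX L i).Cfg, (famX L i).OnMinimalOrbit (O₁ * (L : ℝ) ^ 3 * B₃ * ε₁) V U := by
  sorry

/-- LANDED V2 (the v6 text of `stub_prop8`, now a theorem modulo V2′) — [Balaban1985Variational] PROPOSITION 8 at the d = 3 carriers for the SAME B₃ > 4, by the
kernel-checked halving iteration: p1 g14's `Summit.QuantumFields.YangMills.Theorems.Prop8Iter.prop8_of_halvingLiteral` over lit-balaban's
`B11Prop8Assembly.prop8Printed_of_halvingStep` («We continue this way until we reach the bound B₃ε₁»). [cite: Balaban1985Variational, Prop. 8 p.304] -/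
theorem landed_prop8 : ∀ (L : ℕ), 1 < L → ∃ B₃ : ℝ, 4 < B₃ ∧ Prop8Printed B₃ (famX L) :=
  Summit.QuantumFields.YangMills.Theorems.Prop8Iter.prop8_of_halvingLiteral stub_halvingStep

/-- LANDED V4′ — the log-Lipschitz curvature gradient of critical configurations in (8), p1 g13's
`Summit.QuantumFields.YangMills.Theorems.CritCurvGradLog.stub_critCurvGradLog` (p511133; proved for EVERY (8)-regular configuration, `regPr_curvGrad_lt`;
cell memo HOME/UV3-NODE.md §22). [cite: Balaban1985Variational, Thm 1 (9) p.279; Balaban1985RegularSpaces, Thm 2 (1.36) p.82] -/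
theorem stub_critCurvGradLog : ∀ (L : ℕ), 1 < L → ∀ B₃ : ℝ, 4 < B₃ → ∃ a₁ B₄ : ℝ, 0 < a₁ ∧ 0 < B₄ ∧ CritCurvGradLogAt L a₁ B₃ B₄ :=
  Summit.QuantumFields.YangMills.Theorems.CritCurvGradLog.stub_critCurvGradLog

/-! ## §2 Landed inputs, by name -/

/-- LANDED — located gap G-K1a-2′ (smooth exact one-step lift), v4's `stub_smoothLift`, p466834. [cite: King1986, (A.5) p.676] -/
theorem landed_smoothLift : ∀ (L : ℕ), ∃ C₁ C₂ c : ℝ, 0 < C₁ ∧ 0 ≤ C₂ ∧ 0 < c ∧ SmoothLiftAt L C₁ C₂ c :=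
  Summit.QuantumFields.YangMills.Theorems.SmoothLift.stub_smoothLift

/-- LANDED — located gap G-K1a-3a′ (first-order regularity of the one-step average), p440643. [cite: Balaban1985Averaging, Prop. 3 (122)-(123) p.36] -/
theorem landed_avgCurvGrad : ∀ (L : ℕ), ∃ C₁ C₂ c : ℝ, 0 ≤ C₁ ∧ 0 < C₂ ∧ 0 < c ∧ AvgCurvGradAt L C₁ C₂ c :=
  Summit.QuantumFields.YangMills.Theorems.AvgCurvGrad.stub_avgCurvGrad

/-- LANDED — located gap G-K1a-3b′ (per-configuration averaging action defect), p437535. [cite: Federbush1987PhaseCellIII, Thm 4.3 (4.5) p.299] -/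
theorem landed_avgActionDefect : ∀ (L : ℕ), ∃ C₂ c : ℝ, 0 ≤ C₂ ∧ 0 < c ∧ AvgActionDefectAt L C₂ c :=
  Summit.QuantumFields.YangMills.Theorems.AvgActionDefect.stub_avgActionDefect

/-- **THE VARIATIONAL DATA FROM THE LEAVES** (no sorry of its own): attainment over (6) from V3 (ii) ∧ V2 (w2 `AttainmentOfExist.minSixAttainedAt_of_exist_prop8`),
`MinimisersIn8At` from V2 (p428575 `minimisersIn8At_of_prop8`), and the log-Lipschitz minimiser schema from V4′ ∧ V2 (`minimiserCurvGradLogAt_of_crit`).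
[cite: Balaban1985Variational, Thm 1 p.279, Prop 7 p.299, Prop 8 p.304] -/
theorem variational_of_leaves_log (L : ℕ) (hL : 1 < L) :
    ∃ â₀ â₁ a₀ a₁ B₃ B₄ : ℝ, 0 < â₀ ∧ 0 < â₁ ∧ 0 < a₀ ∧ 0 < a₁ ∧ 0 < B₃ ∧ 0 < B₄ ∧
      MinSixAttainedAt L â₀ â₁ B₃ ∧ MinimisersIn8At L a₀ a₁ B₃ ∧ MinimiserCurvGradLogAt L a₀ a₁ B₃ B₄ := by
  obtain ⟨B₃, hB₃, h8⟩ := landed_prop8 L hL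
  have h7 := stub_existMinimal L hL B₃ hB₃
  obtain ⟨a₁, B₄, ha₁, hB₄, hc⟩ := stub_critCurvGradLog L hL B₃ hB₃
  have hB₃0 : 0 < B₃ := by linarith
  obtain ⟨â₀, â₁, hâ₀, hâ₁, hatt⟩ := Summit.QuantumFields.YangMills.Theorems.AttainmentOfExist.minSixAttainedAt_of_exist_prop8 hL hB₃ h7 h8
  obtain ⟨a₅, ha₅, h8'⟩ := minimisersIn8At_of_prop8 hB₃0 h8
  exact ⟨â₀, â₁, a₅, a₁, B₃, B₄, hâ₀, hâ₁, ha₅, ha₁, hB₃0, hB₄, hatt, h8' a₁, minimiserCurvGradLogAt_of_crit hB₃0 hc (h8' a₁)⟩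

/-! ## §3 The composition — concludes the ROUTE DECL by name, no sorry of its own -/

/-- **`MinimiserStabilityRegPr ⇐ (stub_halvingStep ∧ stub_existMinimal) ∧ landed V4′ `stub_critCurvGradLog` ∧ landed_prop8 (iteration) ∧ landed_smoothLift ∧ landed_avgCurvGrad ∧ landed_avgActionDefect`** (verbatim v8):
EXIST by `T3ExistSplit.hasRegMinimisersPrAt_of_attained`, UPPER by `T3UpperLiftSplitLog.upperAlongRegPrMinimisersAt_of_splitLog'`, LOWER by
`T3SplitLog.lowerAlongRegPrMinimisersAt_of_splitLog'''` (both through the log-Lipschitz schema with K-dependent windows), then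
`minimiserStabilityRegPrAt_of_alongRegPrMinimisers`; ε₁ := min of three, m₀ := 10, γ₁ := min of three; `p₀ > 2 > 0`; `L ≤ 1` is vacuous. -/
theorem MinimiserStabilityRegPr_of : Summit.QuantumFields.YangMills.Theses.UnitScaleTilt.MinimiserStabilityRegPr := by
  intro L
  by_cases hL : 1 < L
  · obtain ⟨â₀, â₁, a₀, a₁, B₃, B₄, hâ₀, hâ₁, ha₀, ha₁, hB₃, hB₄, hatt, hIn8, hgrad⟩ := variational_of_leaves_log L hL
    -- EXIST
    obtain ⟨e₁, he₁, hE⟩ := hasRegMinimisersPrAt_of_attained hâ₀ hâ₁ hB₃ hatt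
    -- UPPER
    obtain ⟨C₁, C₂, c, hC₁, hC₂, hc, hlift⟩ := landed_smoothLift L
    obtain ⟨e₂, he₂, hU⟩ := upperAlongRegPrMinimisersAt_of_splitLog' ha₀ ha₁ hB₃ hB₄ hC₁ hC₂ hc hIn8 hgrad hlift
    -- LOWER
    obtain ⟨D₁, D₂, d, hD₁, hD₂, hd, havg⟩ := landed_avgCurvGrad L
    obtain ⟨E₂, e, hE₂, he, hdef⟩ := landed_avgActionDefect L
    obtain ⟨e₃, he₃, hLo⟩ := lowerAlongRegPrMinimisersAt_of_splitLog''' hL.le ha₀ ha₁ hB₃ hB₄ hD₂ hd hE₂ he hIn8 hgrad havg hdef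
    -- the common `ε₁`, `m₀ = 10`, `γ₁`
    refine ⟨min e₁ (min e₂ e₃), lt_min he₁ (lt_min he₂ he₃), fun ε₀ hε hεle => ⟨10, fun m hm b₀ p₀ hb hp => ?_⟩⟩
    have hε₁ : ε₀ ≤ e₁ := hεle.trans (min_le_left _ _)
    have hε₂ : ε₀ ≤ e₂ := hεle.trans ((min_le_right _ _).trans (min_le_left _ _))
    have hε₃ : ε₀ ≤ e₃ := hεle.trans ((min_le_right _ _).trans (min_le_right _ _))
    have hm2 : 2 ≤ m := le_trans (by norm_num) hm
    have hp0 : 0 < p₀ := lt_trans two_pos hp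
    obtain ⟨γa, hγa, hA⟩ := hE ε₀ hε hε₁ m hm2 b₀ p₀ hb
    obtain ⟨γb, hγb, hB⟩ := hU ε₀ hε hε₂ m hm b₀ p₀ hb hp0
    obtain ⟨γc, hγc, hC⟩ := hLo ε₀ hε hε₃ m hm b₀ p₀ hb hp0
    refine ⟨min γa (min γb γc), lt_min hγa (lt_min hγb hγc), fun F γ hFL hγ hγle => ?_⟩
    have hγa' : γ ≤ γa := hγle.trans (min_le_left _ _)
    have hγb' : γ ≤ γb := hγle.trans ((min_le_right _ _).trans (min_le_left _ _))
    have hγc' : γ ≤ γc := hγle.trans ((min_le_right _ _).trans (min_le_right _ _))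
    exact minimiserStabilityRegPrAt_of_alongRegPrMinimisers hγ.le (hA F γ hFL hγ hγa') (hB F γ hFL hγ hγb') (hC F γ hFL hγ hγc')
  · -- no member of the family has block size `L ≤ 1`
    exact ⟨1, one_pos, fun ε₀ _ _ => ⟨0, fun m _ b₀ p₀ _ _ => ⟨1, one_pos, fun F γ hFL _ _ => absurd (hFL ▸ F.hL.2) hL⟩⟩⟩

end Summit.QuantumFields.YangMills.Cruxes.MinimiserStabilityRegPr.BirthV9

end
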